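import Literature.AnabelianGeometry.SemiGraphs.QuasiTemperoidsHomEqResRel
import Literature.AnabelianGeometry.SemiGraphs.QuasiTemperoidsHomHomRel
import HarnessLib

/-!
# [SemiAnbd] Thm A.4, chart route (Galois-countable case): S1b ≫ S1c composed — from the torsor
# facts of `F` on `T₂[A₂]` to a continuous `f : Π₁ → Π₂` with `B^temp(f)|_{T₂[A₂]} ≅ F`

Mochizuki, *Semi-graphs of anabelioids*, Publ. RIMS **42** (2006) 221–322, Appendix, Thm A.4
(manuscript pp. 82–86) [cite: MochizukiSemiAnbd2006, Thm A.4 pp.82-86]; Prop 3.2 (p. 35).  Proof-only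
companion (seat abc-iut-w5-d220; rows C-S1b/C-S1c of `HOME/plan/L3/SUBDAG-SemiAnbd-Cor311.md`, input
to the assembly row C-S2 of abc-iut-w5-d106): the gluing step `exists_continuousMonoidHom_of_fullSubcategory`
(`QuasiTemperoidsHomHomRel.lean`) fed into abc-iut-w5-d216's comparison
`exists_natIso_res_of_torsorData` (`QuasiTemperoidsHomEqResRel.lean`) with NO adapter; the
surjectivity input of the gluing step is derived from the orbit-map input at the base point of
`Π₂/M` (`proj_eq_orbitMap`).  What remains EXTERNAL are exactly the three torsor facts of step C-S1a
(nonempty + `Π₂`-transitive, `Π₂/N`-free, orbit maps surjective with stabiliser-orbit fibres) for the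
Galois objects `Π₂/N`, `N ≤ M₀`, plus source-closedness of `P` and preservation of countable coproducts.
Restricted (second-countable `Π₂`) theorem; it does not close the typed `ThmA4` (F-1634).  Nothing here
refers to the IUT corpus; no side is taken on any disputed claim.
-/

namespace Literature.AnabelianGeometry.SemiGraphs

namespace BTemp

open CategoryTheory CategoryTheory.Limits Topology Filter

universe u

variable {G₁ : Type u} [Group G₁] [TopologicalSpace G₁] [IsTopologicalGroup G₁]
  {G₂ : Type u} [Group G₂] [TopologicalSpace G₂] [IsTopologicalGroup G₂] (hG₂ : IsTempered G₂)
  (P : ObjectProperty (BTemp G₂)) (F : P.FullSubcategory ⥤ BTemp G₁)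

/-- **S1b ≫ S1c**: from the torsor facts of step S1a
for a functor `F` on a source-closed full subcategory `P` of `B^temp(Π₂)` containing the `Π₂/N`,
`N ≤ M₀`, one gets a continuous homomorphism `f : Π₁ → Π₂` with `P.ι ⋙ B^temp(f) ≅ F`.
[cite: MochizukiSemiAnbd2006, Thm A.4 pp.82-86] -/
theorem exists_hom_natIso_res_of_torsor [SecondCountableTopology G₂] (M₀ : OpenNormalSubgroup G₂)
    (hP₀ : ∀ N : OpenNormalSubgroup G₂, N ≤ M₀ → P (Q hG₂ N))
    (hP : ∀ {X Y : BTemp G₂}, (X ⟶ Y) → P Y → P X)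
    (hcoprod : ∀ (ι : Type) [Countable ι], PreservesColimitsOfShape (Discrete ι) F)
    (htrans : ∀ (N : OpenNormalSubgroup G₂) (hN : N ≤ M₀),
      Nonempty (F.obj ⟨Q hG₂ N, hP₀ N hN⟩).obj.V ∧
      ∀ y y' : (F.obj ⟨Q hG₂ N, hP₀ N hN⟩).obj.V, ∃ g : G₂,
        (F.map (ObjectProperty.homMk (rightMul hG₂ N g) :
          (⟨Q hG₂ N, hP₀ N hN⟩ : P.FullSubcategory) ⟶ ⟨Q hG₂ N, hP₀ N hN⟩)).hom.hom y = y')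
    (hfree : ∀ (N : OpenNormalSubgroup G₂) (hN : N ≤ M₀) {g g' : G₂}
      {y : (F.obj ⟨Q hG₂ N, hP₀ N hN⟩).obj.V},
      (F.map (ObjectProperty.homMk (rightMul hG₂ N g) :
          (⟨Q hG₂ N, hP₀ N hN⟩ : P.FullSubcategory) ⟶ ⟨Q hG₂ N, hP₀ N hN⟩)).hom.hom y =
        (F.map (ObjectProperty.homMk (rightMul hG₂ N g') :
          (⟨Q hG₂ N, hP₀ N hN⟩ : P.FullSubcategory) ⟶ ⟨Q hG₂ N, hP₀ N hN⟩)).hom.hom y →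
      (g : G₂ ⧸ N.toSubgroup) = g')
    (hmo : ∀ (N : OpenNormalSubgroup G₂) (hN : N ≤ M₀) (X : P.FullSubcategory) (x₀ : X.obj.obj.V),
      (∀ x : X.obj.obj.V, ∃ g : G₂, X.obj.obj.ρ g x₀ = x) →
      ∀ hk₀ : N.toSubgroup ≤ stab X.obj x₀,
      (∀ z : (F.obj X).obj.V, ∃ y' : (F.obj ⟨Q hG₂ N, hP₀ N hN⟩).obj.V,
        (F.map (ObjectProperty.homMk (orbitMap hG₂ X.obj x₀ N hk₀))).hom.hom y' = z) ∧
      ∀ y₁ y₂ : (F.obj ⟨Q hG₂ N, hP₀ N hN⟩).obj.V,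
        (F.map (ObjectProperty.homMk (orbitMap hG₂ X.obj x₀ N hk₀))).hom.hom y₁ =
          (F.map (ObjectProperty.homMk (orbitMap hG₂ X.obj x₀ N hk₀))).hom.hom y₂ →
        ∃ h ∈ stab X.obj x₀,
          (F.map (ObjectProperty.homMk (rightMul hG₂ N h))).hom.hom y₁ = y₂) :
    ∃ f : G₁ →ₜ* G₂, Nonempty (P.ι ⋙ BTemp.res f ≅ F) := by
  -- surjectivity of `F` of the projections `Π₂/N → Π₂/M` is `hmo` at the base point of `Π₂/M`
  have hsurj : ∀ (N M : OpenNormalSubgroup G₂) (hN : N ≤ M₀) (hM : M ≤ M₀) (h : N ≤ M)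
      (t : (F.obj ⟨Q hG₂ M, hP₀ M hM⟩).obj.V), ∃ s : (F.obj ⟨Q hG₂ N, hP₀ N hN⟩).obj.V,
      (F.map (ObjectProperty.homMk (proj hG₂ h) :
          (⟨Q hG₂ N, hP₀ N hN⟩ : P.FullSubcategory) ⟶ ⟨Q hG₂ M, hP₀ M hM⟩)).hom.hom s = t := by
    intro N M hN hM h t
    have hN' := le_stab_quotientObj_one hG₂ N M.toSubgroup M.isOpen' h
    have e := proj_eq_orbitMap hG₂ h hN'
    obtain ⟨s, hs⟩ := (hmo N hN ⟨Q hG₂ M, hP₀ M hM⟩ ((1 : G₂) : G₂ ⧸ M.toSubgroup)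
      (quotientObj_transitive hG₂ M.toSubgroup M.isOpen') hN').1 t
    exact ⟨s, by rw [e]; exact hs⟩
  obtain ⟨φ, N, hN, y, hNanti, hNbasis, hycompat, hφ⟩ :=
    exists_continuousMonoidHom_of_fullSubcategory hG₂ F M₀ hP₀ htrans
      (fun N hN => hfree N hN) hsurj
  exact ⟨φ, exists_natIso_res_of_torsorData hG₂ P F hP hcoprod φ N (fun k => hP₀ (N k) (hN k)) y
    hNanti hNbasis hycompat hφ (fun k => (htrans (N k) (hN k)).2)
    (fun k g g' y₁ h => hfree (N k) (hN k) h) (fun k X x₀ htr hk₀ => hmo (N k) (hN k) X x₀ htr hk₀)⟩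

end BTemp

end Literature.AnabelianGeometry.SemiGraphs
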